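import Summits.QuantumFields.YangMills.Theorems.UnitScaleTiltProp7CornerCombCovMassStep
import HarnessLib

/-!
# Route `UnitScaleTilt`, crux K1 «MinimiserStabilityRegPr» (stmt-QuantumFields-19200), route-R E′ (A′)-on-Σ, P-A2 (β), row «(n3)-comb» —
# (O2) GROUNDWORK, file F-7b-2: THE PER-LEVEL `ℓ²` GRADIENT ROW OF THE SOURCELESS COMB TOWER OVER A PERIOD CELL (MINKOWSKI) —
# `√GRAD′ ≤ √(L⁴L⁻ᵈ)·√GRAD + ((24α + 8((d+2)L)²a)·√(d·L²L⁻ᵈ) + 210(2d+2)L·α·√(8d²))·√MASS`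

«(O2) groundwork — not consumed by any displayed row before the freeze lifts» (★★OWNER `ym3-torus-plan` g29∕g30 RULINGS №20 (2), №22 (c) «(II) GO»).
Cell `ym3-torus`, D-0154 (3c) R3 twin-width seat `ym-routeR-w4` (gen 16); pen F-7b named by ★routeR-w1 g9 (PENS ROUND 4, 2026-08-29 08:50Z); the SOURCELESS shape follows
w5-19200 g8's located `#levels` trap (09:02Z): the second-order source is carried by the MASS line only (F-7b-1), the gradient line is run for the sourceless family.
THEOREMS ONLY (0 `def`, 0 `sorry`); `--supports stmt-QuantumFields-19200 --as helper`, count-neutral.  YM₃ on T³ is a ladder rung (R3), not the Clay problem; nothing here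
claims `hMcomb`, `hMcomb₂`, (β), `hPA2`, `hcoS`, the stub, the crux, d = 4 or the mass gap.

THE POINT.  For the SOURCELESS one-step image `X′(z,κ) = T_V(X)(L•z,κ) − (F̂X(L•z) − Ad_{V̄(L•z,κ)}F̂X(L•z+Le_κ)) = L·(Q₀X)(L•z,κ) + DEF(L•z,κ)` (✓F-5a split) of an `N′L`-periodic
level-k field `X` at an `N′L`-periodic unitary background `V` (plaquettes `≤ a`, block loops `≤ α ≤ 1∕24`), the COVARIANT GRADIENT ENERGY over the coarse period cell,
`GRAD′ = Σ_{z∈[0,N′)ᵈ} Σ_{κ,ν} ‖R(V̄(L•z,ν))X′(z+e_ν,κ) − X′(z,κ)‖²`, is bounded by Minkowski (✓`Prop7CornerCombCovMassStep.sqrt_sum_normSq_le_of_le_add₃`) over three pieces: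
(a) the covariant gradient of the straight step — ✓`Prop7CornerCombCovGradTransfer.covGrad_smul_Q0cov_eq` (cov-2: exact split into `Lᵈ·L²` transported covariant unit differences of
weight `L⁻ᵈ` + `Lᵈ·L` re-basing defects `≤ (24α + 8((d+2)L)²a)·‖X‖`, ✓`norm_def_le`), Jensen, and the shifted blocks `L•z + r + t•e_κ + s•e_ν` cover the fine cell once for each
`(t,s)` (§1 over ✓`Prop7CellBoxMultiplicity.sum_cell_shift_vec` + ✓`sum_cell_tiling`) — the SHARP `ρ_g = √(L⁴L⁻ᵈ)` on `GRAD`, `(24α + 8((d+2)L)²a)·√(d·L²L⁻ᵈ)` on `MASS`;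
(b) the covariant gradient of the defect, CRUDELY (`‖R(u)D′ − D‖² ≤ 2‖D′‖² + 2‖D‖²`), the defects at the shifted corners `L•(z + e_ν)` summed by §2 (F-5c at shifted corners:
✓`norm_trueStep_defect_le_twoBlock` + ✓`sum_cell_block_shift_eq`) — `210(2d+2)L·α·√(8d²)` on `MASS`.  So `g_{k+1} ≤ ρ_g·g_k + κ_k·m_k`, `κ_k ∝ α_k, a_k` geometric from the
top under `RegPr` — the row ✓`Prop7CornerCombLevelInduction.grad_line_le` (F-7c-1) iterates, log-free.
HONEST SCOPE.  Jensen + Minkowski + period-cell bookkeeping over cited tree∕lit theorems; windows are hypotheses; `𝔸` any non-trivial C⋆-algebra; every `d`, `L ≥ 1`, `N′ ≥ 1`.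

References: T. Bałaban, CMP **98** (1985) 17–51 [Balaban1985Averaging] ((2) p.17, (42)–(47) pp.23–25, Prop. 3 (122)–(126) p.36); CMP **95** (1984) 17–40 [Balaban1984PropagatorsI]
((1.18)–(1.20) pp.19–20); CMP **109** (1987) 249–301 [Balaban1987RG1] ((0.1) p.251).
-/

noncomputable section

open scoped BigOperators
open Finset
namespace Summit.QuantumFields.YangMills.Theorems.Prop7CornerCombCovGradStep

open NormedSpace
open Literature.MathematicalPhysics.QuantumFieldTheory.Balaban1983to89
open ExpMeanLog (eml)
open B7Prop1Explicit (Site Letter e hol seg treeWord boxVec gammaWord Wcx Xavg bavg expUnit U1 plaqWord hol_mem)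
open B7Prop2Explicit (unitaryUnits unitaryUnits_le_U1 bavg_mem_unitaryUnits)
open B7Eq78Linearization (conjR conjR_add)
open B7Prop3GeneralRotated (tsum norm_conjR_le)
open B7Prop3GeneralLinear (FhatCov Q0cov)
open Summit.QuantumFields.YangMills.Theorems.Prop7CornerCombCovGradTransfer (covGrad_smul_Q0cov_eq norm_def_le)
open Summit.QuantumFields.YangMills.Theorems.Prop7CornerCombCovMassStep (sqrt_sum_normSq_le_of_le_add₃ sq_sum_const_mul_le)
open Summit.QuantumFields.YangMills.Theorems.Prop7CombTrueStepDefectTwoBlock (norm_trueStep_defect_le_twoBlock)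
open Summit.QuantumFields.YangMills.Theorems.Prop7CombTrueStepDefectCell (sum_cell_tiling)
open Summit.QuantumFields.YangMills.Theorems.Prop7CellBoxMultiplicity (sum_cell_shift_vec sum_cell_block_shift_eq)

/-! ## §1 Blocks shifted by a fine vector cover the fine cell exactly once -/

section Bookkeeping

variable {d : ℕ}

/-- **BLOCKS + FINE SHIFT**: `Σ_{z∈[0,N′)ᵈ} Σ_{r∈[0,L)ᵈ} f(L•z + r + v) = Σ_{t′∈[0,N′L)ᵈ} f(t′)` for `N′L`-periodic `f`, any `v`. [cite: Balaban1985Averaging, (2) p.17; Balaban1987RG1, (0.1) p.251] -/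
theorem sum_blocks_fineShift_eq_sum_cell {M : Type*} [AddCommMonoid M] (L N' : ℕ) (hL : 1 ≤ L) [NeZero N'] (f : Site d → M)
    (hf : ∀ (x : Site d) (κ : Fin d), f (x + ((N' * L : ℕ) : ℤ) • e κ) = f x) (v : Site d) :
    ∑ z : Fin d → Fin N', ∑ r : Fin d → Fin L, f ((L : ℤ) • boxVec N' z + boxVec L r + v)
      = ∑ t' : Fin d → Fin (N' * L), f (boxVec (N' * L) t') := by
  haveI : NeZero (N' * L) := ⟨Nat.mul_ne_zero (NeZero.ne N') (by omega)⟩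
  rw [← sum_cell_shift_vec (N' * L) f hf v, sum_cell_tiling N' L hL (fun y => f (y + v))]

end Bookkeeping

section Defect

variable {d : ℕ} {𝔸 : Type*} [CStarAlgebra 𝔸] [Nontrivial 𝔸]

/-! ## §2 The one-step defect over the cell at SHIFTED corners `L•(z + v)` -/

/-- ★ **THE DEFECT OVER THE CELL AT SHIFTED CORNERS** (✓F-5c `sum_cell_trueStep_defect_sq_le` with corners `L•(z + v)`, any coarse `v`; block loops `≤ α ≤ 1∕24` at every corner):
`Σ_{z,κ} ‖DEF(L•(z+v), κ)‖² ≤ (210(2d+2)L)²·α²·2d·Σ_{t′,ν}‖X(t′,ν)‖²` — F-5b squared; the two blocks at the shifted corners cover the fine cell `2d` times (✓`sum_cell_block_shift_eq`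
at `v`, `v + e_κ`). [cite: Balaban1985Averaging, (2) p.17, (42)-(43) pp.23-24, (124)-(126) p.36] -/
theorem sum_cell_trueStep_defect_sq_le_shift (L N' : ℕ) (hL : 1 ≤ L) [NeZero N'] (V : Site d → Fin d → 𝔸ˣ) (hV : ∀ x μ, V x μ ∈ unitaryUnits 𝔸)
    (X : Site d → Fin d → 𝔸) (hX : ∀ (x : Site d) (κ μ : Fin d), X (x + ((N' * L : ℕ) : ℤ) • e κ) μ = X x μ) {α : ℝ}
    (hα : ∀ (z : Site d) (κ : Fin d) (r : Fin d → Fin L), ‖((Wcx L V ((L : ℤ) • z) κ (boxVec L r) : 𝔸ˣ) : 𝔸) - 1‖ ≤ α) (hα24 : α ≤ 1 / 24) (v : Site d) :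
    ∑ z : Fin d → Fin N', ∑ κ : Fin d,
      ‖fderiv ℂ (eml : ((Fin d → Fin L) → 𝔸) → 𝔸) (fun r => ((Wcx L V ((L : ℤ) • (boxVec N' z + v)) κ (boxVec L r) : 𝔸ˣ) : 𝔸))
            (fun r => tsum V X ((L : ℤ) • (boxVec N' z + v)) (gammaWord L κ (boxVec L r) ++ seg κ (-(L : ℤ)))
              * ((Wcx L V ((L : ℤ) • (boxVec N' z + v)) κ (boxVec L r) : 𝔸ˣ) : 𝔸))
            * (((expUnit (Xavg L V ((L : ℤ) • (boxVec N' z + v)) κ))⁻¹ : 𝔸ˣ) : 𝔸)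
          + ((expUnit (Xavg L V ((L : ℤ) • (boxVec N' z + v)) κ) : 𝔸ˣ) : 𝔸) * tsum V X ((L : ℤ) • (boxVec N' z + v)) (seg κ (L : ℤ))
            * (((expUnit (Xavg L V ((L : ℤ) • (boxVec N' z + v)) κ))⁻¹ : 𝔸ˣ) : 𝔸)
          - (FhatCov L V X ((L : ℤ) • (boxVec N' z + v)) - conjR (bavg L V ((L : ℤ) • (boxVec N' z + v)) κ) (FhatCov L V X ((L : ℤ) • (boxVec N' z + v) + (L : ℤ) • e κ))
              + (L : ℝ) • Q0cov L V X ((L : ℤ) • (boxVec N' z + v)) κ)‖ ^ 2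
      ≤ (210 * ((2 * d + 2) * L)) ^ 2 * α ^ 2 * (2 * d) * ∑ t' : Fin d → Fin (N' * L), ∑ ν : Fin d, ‖X (boxVec (N' * L) t') ν‖ ^ 2 := by
  set F : Site d → ℝ := fun y => ∑ ν : Fin d, ‖X y ν‖ ^ 2 with hF
  have hFper : ∀ (x : Site d) (κ : Fin d), F (x + ((N' * L : ℕ) : ℤ) • e κ) = F x := fun x κ => by simp only [hF, hX]
  set A : Site d → ℝ := fun y => ∑ s : Fin d → Fin L, F (y + boxVec L s) with hA
  set C : ℝ := (210 * ((2 * d + 2) * L)) ^ 2 * α ^ 2 with hC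
  set S : ℝ := ∑ t' : Fin d → Fin (N' * L), ∑ ν : Fin d, ‖X (boxVec (N' * L) t') ν‖ ^ 2 with hS
  -- pointwise: F-5b squared
  have hpt : ∀ (q : Site d) (κ : Fin d), (∀ r : Fin d → Fin L, ‖((Wcx L V q κ (boxVec L r) : 𝔸ˣ) : 𝔸) - 1‖ ≤ α) →
      ‖fderiv ℂ (eml : ((Fin d → Fin L) → 𝔸) → 𝔸) (fun r => ((Wcx L V q κ (boxVec L r) : 𝔸ˣ) : 𝔸))
            (fun r => tsum V X q (gammaWord L κ (boxVec L r) ++ seg κ (-(L : ℤ))) * ((Wcx L V q κ (boxVec L r) : 𝔸ˣ) : 𝔸))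
            * (((expUnit (Xavg L V q κ))⁻¹ : 𝔸ˣ) : 𝔸)
          + ((expUnit (Xavg L V q κ) : 𝔸ˣ) : 𝔸) * tsum V X q (seg κ (L : ℤ)) * (((expUnit (Xavg L V q κ))⁻¹ : 𝔸ˣ) : 𝔸)
          - (FhatCov L V X q - conjR (bavg L V q κ) (FhatCov L V X (q + (L : ℤ) • e κ)) + (L : ℝ) • Q0cov L V X q κ)‖ ^ 2
        ≤ C * (A q + A (q + (L : ℤ) • e κ)) := by
    intro q κ hαq
    have h := norm_trueStep_defect_le_twoBlock L hL V hV X q κ hαq hα24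
    refine (pow_le_pow_left₀ (norm_nonneg _) h 2).trans_eq ?_
    have hB : ∑ s : Fin d → Fin L, ∑ ν : Fin d, (‖X (q + boxVec L s) ν‖ ^ 2 + ‖X (q + (L : ℤ) • e κ + boxVec L s) ν‖ ^ 2) = A q + A (q + (L : ℤ) • e κ) := by
      simp only [hA, hF, Finset.sum_add_distrib]
    rw [mul_pow, mul_pow, mul_pow, Real.sq_sqrt (by positivity), hB, hC]
    ring
  -- the blocks at the shifted corners `L•(z + v)` and `L•(z + v + e_κ)` each tile the fine cell
  have hlow : ∑ z : Fin d → Fin N', A ((L : ℤ) • (boxVec N' z + v)) = S := by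
    simp only [hA, hS, hF]
    exact sum_cell_block_shift_eq N' L hL (N' * L) rfl (fun y => ∑ ν : Fin d, ‖X y ν‖ ^ 2) (fun y κ => by simp only [hX]) v
  have hup : ∀ κ : Fin d, ∑ z : Fin d → Fin N', A ((L : ℤ) • (boxVec N' z + v) + (L : ℤ) • e κ) = S := fun κ => by
    have h := sum_cell_block_shift_eq N' L hL (N' * L) rfl (fun y => ∑ ν : Fin d, ‖X y ν‖ ^ 2) (fun y κ => by simp only [hX]) (v + e κ)
    simp only [hA, hS, hF]
    rw [← h]
    refine Finset.sum_congr rfl fun z _ => Finset.sum_congr rfl fun s _ => ?_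
    rw [← add_assoc, smul_add ((L : ℤ)) (boxVec N' z + v) (e κ)]
  calc _ ≤ ∑ z : Fin d → Fin N', ∑ κ : Fin d, C * (A ((L : ℤ) • (boxVec N' z + v)) + A ((L : ℤ) • (boxVec N' z + v) + (L : ℤ) • e κ)) :=
        Finset.sum_le_sum fun z _ => Finset.sum_le_sum fun κ _ => hpt _ κ (hα _ κ)
    _ = C * (∑ κ : Fin d, (∑ z : Fin d → Fin N', A ((L : ℤ) • (boxVec N' z + v)) + ∑ z : Fin d → Fin N', A ((L : ℤ) • (boxVec N' z + v) + (L : ℤ) • e κ))) := by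
        rw [Finset.sum_comm, Finset.mul_sum]
        refine Finset.sum_congr rfl fun κ _ => ?_
        rw [← Finset.sum_add_distrib, Finset.mul_sum]
    _ = C * (2 * d) * S := by
        simp only [hlow, hup]
        rw [Finset.sum_const, Finset.card_univ, Fintype.card_fin, nsmul_eq_mul]
        ring
    _ = _ := by rw [hC, hS]

end Defect

/-! ## §3 ★★★ The gradient row: Minkowski over the cell -/

section Row

variable {d : ℕ} {𝔸 : Type*} [CStarAlgebra 𝔸] [Nontrivial 𝔸]

omit [Nontrivial 𝔸] in
/-- `Σ_a Σ_b Σ_c = Σ_b Σ_c Σ_a` over finite types. [folklore] -/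
private theorem sum_comm₃ {α β γ : Type*} [Fintype α] [Fintype β] [Fintype γ] (f : α → β → γ → ℝ) :
    ∑ a, ∑ b, ∑ c, f a b c = ∑ b, ∑ c, ∑ a, f a b c := by
  rw [Finset.sum_comm]
  exact Finset.sum_congr rfl fun b _ => Finset.sum_comm

omit [Nontrivial 𝔸] in
/-- `Σ_a Σ_b Σ_c = Σ_c Σ_a Σ_b` over finite types. [folklore] -/
private theorem sum_comm₃' {α β γ : Type*} [Fintype α] [Fintype β] [Fintype γ] (f : α → β → γ → ℝ) :
    ∑ a, ∑ b, ∑ c, f a b c = ∑ c, ∑ a, ∑ b, f a b c := by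
  calc ∑ a, ∑ b, ∑ c, f a b c = ∑ a, ∑ c, ∑ b, f a b c := Finset.sum_congr rfl fun a _ => Finset.sum_comm
    _ = _ := Finset.sum_comm

/-- ★★★ **THE PER-LEVEL `ℓ²` GRADIENT ROW OF THE SOURCELESS COMB TOWER (MINKOWSKI OVER ONE PERIOD CELL).**  `𝔸` a non-trivial C⋆-algebra; `V` unitary-valued and `N′L`-periodic on `ℤᵈ`,
every plaquette holonomy within `a` of `1`, every block loop of every corner `L•z` within `α ≤ 1∕24` of `1`; `X` an `N′L`-periodic level-k field; `X′` its SOURCELESS one-step image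
`X′(z,κ) = T_V(X)(L•z,κ) − (F̂_V X(L•z) − Ad_{V̄(L•z,κ)} F̂_V X(L•z + Le_κ))` at EVERY coarse site (F-7a's recursion with `CM := F̂`, `rem = 0`).  Then the covariant gradient energy of `X′`
at the coarse background `V̄ = bavg L V (L•·)` over the coarse period cell obeys
`√Σ_{z,κ,ν}‖R(V̄(L•z,ν))X′(z+e_ν,κ) − X′(z,κ)‖² ≤ √(L⁴L⁻ᵈ)·√Σ_{t′,κ,ν}‖R(V(t′,ν))X(t′+e_ν,κ) − X(t′,κ)‖² + ((24α + 8((d+2)L)²a)·√(d·(L²L⁻ᵈ)) + 210(2d+2)L·α·√(8d²))·√Σ_{t′,ν}‖X(t′,ν)‖²`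
— the row `g_{k+1} ≤ ρ_g·g_k + κ_k·m_k`, `ρ_g = L^{(4−d)∕2}`, `κ_k = O(α_k + L²a_k)` (cov-2 §3 on the cell + the crude gradient of the defect, §2).
«(O2) groundwork — not consumed by any displayed row before the freeze lifts.»
[cite: Balaban1985Averaging, (2) p.17, (42)-(47) pp.23-25, Prop. 3 (122)-(126) p.36] [cite: Balaban1984PropagatorsI, (1.18)-(1.20) pp.19-20] -/
theorem sqrt_sum_cell_normSq_covGrad_step_le (L N' : ℕ) (hL : 1 ≤ L) [NeZero N'] (V : Site d → Fin d → 𝔸ˣ) (hV : ∀ x μ, V x μ ∈ unitaryUnits 𝔸)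
    (hVper : ∀ (x : Site d) (κ μ : Fin d), V (x + ((N' * L : ℕ) : ℤ) • e κ) μ = V x μ)
    {a : ℝ} (ha : 0 ≤ a) (hplaq : ∀ (x : Site d) (κ' μ : Fin d), κ' ≠ μ → ‖((hol V x (plaqWord κ' μ) : 𝔸ˣ) : 𝔸) - 1‖ ≤ a)
    {α : ℝ} (hα0 : 0 ≤ α) (hα24 : α ≤ 1 / 24)
    (hα : ∀ (z : Site d) (κ : Fin d) (r : Fin d → Fin L), ‖((Wcx L V ((L : ℤ) • z) κ (boxVec L r) : 𝔸ˣ) : 𝔸) - 1‖ ≤ α)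
    (X X' : Site d → Fin d → 𝔸) (hX : ∀ (x : Site d) (κ μ : Fin d), X (x + ((N' * L : ℕ) : ℤ) • e κ) μ = X x μ)
    (hX' : ∀ (z : Site d) (κ : Fin d), X' z κ
      = fderiv ℂ (eml : ((Fin d → Fin L) → 𝔸) → 𝔸) (fun r => ((Wcx L V ((L : ℤ) • z) κ (boxVec L r) : 𝔸ˣ) : 𝔸))
            (fun r => tsum V X ((L : ℤ) • z) (gammaWord L κ (boxVec L r) ++ seg κ (-(L : ℤ))) * ((Wcx L V ((L : ℤ) • z) κ (boxVec L r) : 𝔸ˣ) : 𝔸))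
            * (((expUnit (Xavg L V ((L : ℤ) • z) κ))⁻¹ : 𝔸ˣ) : 𝔸)
          + ((expUnit (Xavg L V ((L : ℤ) • z) κ) : 𝔸ˣ) : 𝔸) * tsum V X ((L : ℤ) • z) (seg κ (L : ℤ))
            * (((expUnit (Xavg L V ((L : ℤ) • z) κ))⁻¹ : 𝔸ˣ) : 𝔸)
        - (FhatCov L V X ((L : ℤ) • z) - conjR (bavg L V ((L : ℤ) • z) κ) (FhatCov L V X ((L : ℤ) • z + (L : ℤ) • e κ)))) :
    Real.sqrt (∑ z : Fin d → Fin N', ∑ κ : Fin d, ∑ ν : Fin d,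
        ‖conjR (bavg L V ((L : ℤ) • boxVec N' z) ν) (X' (boxVec N' z + e ν) κ) - X' (boxVec N' z) κ‖ ^ 2)
      ≤ Real.sqrt ((L : ℝ) ^ 4 * ((L : ℝ) ^ d)⁻¹)
          * Real.sqrt (∑ t' : Fin d → Fin (N' * L), ∑ κ : Fin d, ∑ ν : Fin d, ‖conjR (V (boxVec (N' * L) t') ν) (X (boxVec (N' * L) t' + e ν) κ) - X (boxVec (N' * L) t') κ‖ ^ 2)
        + ((24 * α + 8 * (((d : ℝ) + 2) * L) ^ 2 * a) * Real.sqrt (d * ((L : ℝ) ^ 2 * ((L : ℝ) ^ d)⁻¹))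
            + 210 * ((2 * d + 2) * L) * α * Real.sqrt (8 * (d : ℝ) ^ 2))
          * Real.sqrt (∑ t' : Fin d → Fin (N' * L), ∑ ν : Fin d, ‖X (boxVec (N' * L) t') ν‖ ^ 2) := by
  classical
  have hV' : ∀ x μ, V x μ ∈ U1 𝔸 := fun x μ => unitaryUnits_le_U1 (hV x μ)
  set c : ℝ := ((L : ℝ) ^ d)⁻¹ with hc
  have hc0 : 0 ≤ c := by positivity
  have hLd : (L : ℝ) ^ d * c = 1 := by
    rw [hc]; exact mul_inv_cancel₀ (pow_ne_zero _ (by exact_mod_cast (show L ≠ 0 by omega)))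
  set K : ℝ := 24 * α + 8 * (((d : ℝ) + 2) * L) ^ 2 * a with hK
  have hK0 : 0 ≤ K := by positivity
  -- the straight step and the defect, as functions of the corner
  set Sq : Site d → Fin d → 𝔸 := fun q κ => (L : ℝ) • Q0cov L V X q κ with hSq
  set Dq : Site d → Fin d → 𝔸 := fun q κ =>
    fderiv ℂ (eml : ((Fin d → Fin L) → 𝔸) → 𝔸) (fun r => ((Wcx L V q κ (boxVec L r) : 𝔸ˣ) : 𝔸))
          (fun r => tsum V X q (gammaWord L κ (boxVec L r) ++ seg κ (-(L : ℤ))) * ((Wcx L V q κ (boxVec L r) : 𝔸ˣ) : 𝔸))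
          * (((expUnit (Xavg L V q κ))⁻¹ : 𝔸ˣ) : 𝔸)
        + ((expUnit (Xavg L V q κ) : 𝔸ˣ) : 𝔸) * tsum V X q (seg κ (L : ℤ)) * (((expUnit (Xavg L V q κ))⁻¹ : 𝔸ˣ) : 𝔸)
      - (FhatCov L V X q - conjR (bavg L V q κ) (FhatCov L V X (q + (L : ℤ) • e κ)) + (L : ℝ) • Q0cov L V X q κ) with hDq
  have hdec : ∀ (z : Site d) (κ : Fin d), X' z κ = Sq ((L : ℤ) • z) κ + Dq ((L : ℤ) • z) κ := by
    intro z κ; simp only [hSq, hDq]; rw [hX' z κ]; abel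
  -- gradient and mass densities on the fine lattice
  set G : Fin d → Fin d → Site d → ℝ := fun κ ν w => ‖conjR (V w ν) (X (w + e ν) κ) - X w κ‖ with hG
  set M : Fin d → Site d → ℝ := fun κ w => ‖X w κ‖ with hM
  have hGper : ∀ (κ ν : Fin d) (w : Site d) (μ : Fin d), G κ ν (w + ((N' * L : ℕ) : ℤ) • e μ) = G κ ν w := fun κ ν w μ => by
    simp only [hG]; rw [add_right_comm, hVper, hX, hX]
  have hMper : ∀ (κ : Fin d) (w : Site d) (μ : Fin d), M κ (w + ((N' * L : ℕ) : ℤ) • e μ) = M κ w := fun κ w μ => by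
    simp only [hM, hX]
  -- index sets of the unfolded straight step
  set I : Finset ((Fin d → Fin L) × (ℕ × ℕ)) := (Finset.univ : Finset (Fin d → Fin L)) ×ˢ (Finset.range L ×ˢ Finset.range L) with hI
  set I' : Finset ((Fin d → Fin L) × ℕ) := (Finset.univ : Finset (Fin d → Fin L)) ×ˢ Finset.range L with hI'
  have hcardI : (#I : ℝ) = (L : ℝ) ^ d * L * L := by
    rw [hI, Finset.card_product, Finset.card_product, Finset.card_univ, Fintype.card_fun, Fintype.card_fin, Fintype.card_fin, Finset.card_range]
    push_cast; ring
  have hcardI' : (#I' : ℝ) = (L : ℝ) ^ d * L := by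
    rw [hI', Finset.card_product, Finset.card_univ, Fintype.card_fun, Fintype.card_fin, Fintype.card_fin, Finset.card_range]
    push_cast; ring
  -- the three dominating families, indexed by `p = (z, κ, ν)`
  set π : (Fin d → Fin N') → Fin d → Fin d → (Fin d → Fin L) × (ℕ × ℕ) → Site d :=
    fun z κ ν s => (L : ℤ) • boxVec N' z + boxVec L s.1 + (s.2.1 : ℤ) • e κ + (s.2.2 : ℤ) • e ν with hπ
  set π' : (Fin d → Fin N') → Fin d → Fin d → (Fin d → Fin L) × ℕ → Site d :=
    fun z κ ν s => (L : ℤ) • boxVec N' z + boxVec L s.1 + (s.2 : ℤ) • e κ + (L : ℤ) • e ν with hπ'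
  set A : (Fin d → Fin N') × Fin d × Fin d → ℝ := fun p => ∑ s ∈ I, c * G p.2.1 p.2.2 (π p.1 p.2.1 p.2.2 s) with hA
  set B : (Fin d → Fin N') × Fin d × Fin d → ℝ := fun p => ∑ s ∈ I', (c * K) * M p.2.1 (π' p.1 p.2.1 p.2.2 s) with hB
  set Cd : (Fin d → Fin N') × Fin d × Fin d → ℝ := fun p =>
    ‖Dq ((L : ℤ) • (boxVec N' p.1 + e p.2.2)) p.2.1‖ + ‖Dq ((L : ℤ) • boxVec N' p.1) p.2.1‖ with hCd
  -- STEP 1: the pointwise domination `‖∇X′‖ ≤ A + B + Cd`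
  have hpt : ∀ p ∈ (Finset.univ : Finset ((Fin d → Fin N') × Fin d × Fin d)),
      ‖conjR (bavg L V ((L : ℤ) • boxVec N' p.1) p.2.2) (X' (boxVec N' p.1 + e p.2.2) p.2.1) - X' (boxVec N' p.1) p.2.1‖ ≤ A p + B p + Cd p := by
    rintro ⟨z, κ, ν⟩ _
    have hq' : (L : ℤ) • (boxVec N' z + e ν) = (L : ℤ) • boxVec N' z + (L : ℤ) • e ν := smul_add _ _ _
    rw [hdec, hdec, conjR_add]
    have hsplit : conjR (bavg L V ((L : ℤ) • boxVec N' z) ν) (Sq ((L : ℤ) • (boxVec N' z + e ν)) κ) + conjR (bavg L V ((L : ℤ) • boxVec N' z) ν) (Dq ((L : ℤ) • (boxVec N' z + e ν)) κ)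
          - (Sq ((L : ℤ) • boxVec N' z) κ + Dq ((L : ℤ) • boxVec N' z) κ)
        = (conjR (bavg L V ((L : ℤ) • boxVec N' z) ν) (Sq ((L : ℤ) • boxVec N' z + (L : ℤ) • e ν) κ) - Sq ((L : ℤ) • boxVec N' z) κ)
          + (conjR (bavg L V ((L : ℤ) • boxVec N' z) ν) (Dq ((L : ℤ) • (boxVec N' z + e ν)) κ) - Dq ((L : ℤ) • boxVec N' z) κ) := by
      rw [hq']; abel
    rw [hsplit]
    refine (norm_add_le _ _).trans (add_le_add ?_ ?_)
    · -- the straight step: cov-2's exact split, transports isometric, defects by `norm_def_le`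
      simp only [hSq, hA, hB, hI, hI', hπ, hπ', hG, hM, Finset.sum_product]
      rw [covGrad_smul_Q0cov_eq L hL V X ((L : ℤ) • boxVec N' z) κ ν, ← Finset.sum_add_distrib]
      refine (norm_sum_le _ _).trans (Finset.sum_le_sum fun r _ => ?_)
      rw [← Finset.sum_add_distrib]
      refine (norm_sum_le _ _).trans (Finset.sum_le_sum fun t ht => ?_)
      have ht' : t < L := Finset.mem_range.mp ht
      rw [norm_smul, Real.norm_of_nonneg hc0, ← Finset.mul_sum, mul_assoc c K, ← mul_add]
      refine mul_le_mul_of_nonneg_left ((norm_add_le _ _).trans (add_le_add ?_ ?_)) hc0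
      · refine (norm_sum_le _ _).trans (Finset.sum_le_sum fun s _ => ?_)
        exact norm_conjR_le (hol_mem hV' _ _) _
      · exact norm_def_le L V hV ha hplaq hα0 hα24 ((L : ℤ) • boxVec N' z) ν (hα _ ν) X κ r t ht'
    · -- the defect: crudely
      simp only [hCd]
      refine (norm_sub_le _ _).trans (add_le_add ?_ le_rfl)
      exact norm_conjR_le (unitaryUnits_le_U1 (bavg_mem_unitaryUnits hV L _ ν fun r => (hα _ ν r).trans (hα24.trans (by norm_num)))) _
  -- STEP 2: Minkowski over `(z, κ, ν)`
  have hMink := sqrt_sum_normSq_le_of_le_add₃ (Finset.univ : Finset ((Fin d → Fin N') × Fin d × Fin d))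
    (fun p => conjR (bavg L V ((L : ℤ) • boxVec N' p.1) p.2.2) (X' (boxVec N' p.1 + e p.2.2) p.2.1) - X' (boxVec N' p.1) p.2.1)
    A B Cd hpt
  simp only [Fintype.sum_prod_type] at hMink
  -- the fine-cell energies
  set CELLG : Fin d → Fin d → ℝ := fun κ ν => ∑ t' : Fin d → Fin (N' * L), G κ ν (boxVec (N' * L) t') ^ 2 with hCELLG
  set CELLM : Fin d → ℝ := fun κ => ∑ t' : Fin d → Fin (N' * L), M κ (boxVec (N' * L) t') ^ 2 with hCELLM
  set MASS : ℝ := ∑ t' : Fin d → Fin (N' * L), ∑ ν : Fin d, ‖X (boxVec (N' * L) t') ν‖ ^ 2 with hMASS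
  have hMASS' : ∑ κ : Fin d, CELLM κ = MASS := by simp only [hCELLM, hMASS, hM]; exact Finset.sum_comm
  have hCELLM0 : ∀ κ, 0 ≤ CELLM κ := fun κ => by positivity
  -- STEP 3: the gradient part, per `(κ, ν)`: Jensen + the shifted blocks cover the fine cell once for each `(t, s)`
  have h3 : ∀ κ ν : Fin d, ∑ z : Fin d → Fin N', A (z, κ, ν) ^ 2 ≤ ((L : ℝ) ^ 4 * c) * CELLG κ ν := by
    intro κ ν
    have hstep : ∀ z : Fin d → Fin N', A (z, κ, ν) ^ 2 ≤ ((L : ℝ) ^ 2 * c) * ∑ s ∈ I, G κ ν (π z κ ν s) ^ 2 := by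
      intro z
      refine (sq_sum_const_mul_le I c fun s => G κ ν (π z κ ν s)).trans (le_of_eq ?_)
      rw [hcardI]; congr 1
      calc (L : ℝ) ^ d * L * L * c ^ 2 = ((L : ℝ) ^ d * c) * ((L : ℝ) ^ 2 * c) := by ring
        _ = (L : ℝ) ^ 2 * c := by rw [hLd, one_mul]
    have hcov : ∀ ts : ℕ × ℕ, ∑ z : Fin d → Fin N', ∑ r : Fin d → Fin L, G κ ν (π z κ ν (r, ts)) ^ 2 = CELLG κ ν := by
      intro ts
      have h := sum_blocks_fineShift_eq_sum_cell L N' hL (fun w => G κ ν w ^ 2) (fun w μ => by simp only [hGper])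
        ((ts.1 : ℤ) • e κ + (ts.2 : ℤ) • e ν)
      simp only [hπ, hCELLG]
      rw [← h]
      refine Finset.sum_congr rfl fun z _ => Finset.sum_congr rfl fun r _ => ?_
      rw [add_assoc ((L : ℤ) • boxVec N' z + boxVec L r)]
    calc ∑ z : Fin d → Fin N', A (z, κ, ν) ^ 2
        ≤ ∑ z : Fin d → Fin N', ((L : ℝ) ^ 2 * c) * ∑ s ∈ I, G κ ν (π z κ ν s) ^ 2 := Finset.sum_le_sum fun z _ => hstep z
      _ = ((L : ℝ) ^ 2 * c) * ∑ ts ∈ Finset.range L ×ˢ Finset.range L, ∑ z : Fin d → Fin N', ∑ r : Fin d → Fin L, G κ ν (π z κ ν (r, ts)) ^ 2 := by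
          rw [← Finset.mul_sum]
          congr 1
          calc ∑ z : Fin d → Fin N', ∑ s ∈ I, G κ ν (π z κ ν s) ^ 2
              = ∑ z : Fin d → Fin N', ∑ ts ∈ Finset.range L ×ˢ Finset.range L, ∑ r : Fin d → Fin L, G κ ν (π z κ ν (r, ts)) ^ 2 := by
                refine Finset.sum_congr rfl fun z _ => ?_
                rw [hI, Finset.sum_product]
                exact Finset.sum_comm
            _ = _ := Finset.sum_comm
      _ = ((L : ℝ) ^ 2 * c) * ∑ ts ∈ Finset.range L ×ˢ Finset.range L, CELLG κ ν := by simp only [hcov]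
      _ = ((L : ℝ) ^ 4 * c) * CELLG κ ν := by
          rw [Finset.sum_const, Finset.card_product, Finset.card_range, nsmul_eq_mul]; push_cast; ring
  -- STEP 4: the mass-defect part, per `(κ, ν)`
  have h4 : ∀ κ ν : Fin d, ∑ z : Fin d → Fin N', B (z, κ, ν) ^ 2 ≤ (K ^ 2 * ((L : ℝ) ^ 2 * c)) * CELLM κ := by
    intro κ ν
    have hstep : ∀ z : Fin d → Fin N', B (z, κ, ν) ^ 2 ≤ ((L : ℝ) * c * K ^ 2) * ∑ s ∈ I', M κ (π' z κ ν s) ^ 2 := by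
      intro z
      refine (sq_sum_const_mul_le I' (c * K) fun s => M κ (π' z κ ν s)).trans (le_of_eq ?_)
      rw [hcardI']; congr 1
      calc (L : ℝ) ^ d * L * (c * K) ^ 2 = ((L : ℝ) ^ d * c) * (L * c * K ^ 2) := by ring
        _ = (L : ℝ) * c * K ^ 2 := by rw [hLd, one_mul]
    have hcov : ∀ t : ℕ, ∑ z : Fin d → Fin N', ∑ r : Fin d → Fin L, M κ (π' z κ ν (r, t)) ^ 2 = CELLM κ := by
      intro t
      have h := sum_blocks_fineShift_eq_sum_cell L N' hL (fun w => M κ w ^ 2) (fun w μ => by simp only [hMper])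
        ((t : ℤ) • e κ + (L : ℤ) • e ν)
      simp only [hπ', hCELLM]
      rw [← h]
      refine Finset.sum_congr rfl fun z _ => Finset.sum_congr rfl fun r _ => ?_
      rw [add_assoc ((L : ℤ) • boxVec N' z + boxVec L r)]
    calc ∑ z : Fin d → Fin N', B (z, κ, ν) ^ 2
        ≤ ∑ z : Fin d → Fin N', ((L : ℝ) * c * K ^ 2) * ∑ s ∈ I', M κ (π' z κ ν s) ^ 2 := Finset.sum_le_sum fun z _ => hstep z
      _ = ((L : ℝ) * c * K ^ 2) * ∑ t ∈ Finset.range L, ∑ z : Fin d → Fin N', ∑ r : Fin d → Fin L, M κ (π' z κ ν (r, t)) ^ 2 := by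
          rw [← Finset.mul_sum]
          congr 1
          calc ∑ z : Fin d → Fin N', ∑ s ∈ I', M κ (π' z κ ν s) ^ 2
              = ∑ z : Fin d → Fin N', ∑ t ∈ Finset.range L, ∑ r : Fin d → Fin L, M κ (π' z κ ν (r, t)) ^ 2 := by
                refine Finset.sum_congr rfl fun z _ => ?_
                rw [hI', Finset.sum_product]
                exact Finset.sum_comm
            _ = _ := Finset.sum_comm
      _ = ((L : ℝ) * c * K ^ 2) * ∑ t ∈ Finset.range L, CELLM κ := by simp only [hcov]
      _ = (K ^ 2 * ((L : ℝ) ^ 2 * c)) * CELLM κ := by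
          rw [Finset.sum_const, Finset.card_range, nsmul_eq_mul]; ring
  -- STEP 5: the defect part (§2 at the corners `L•z` and `L•(z + e_ν)`)
  set CD : ℝ := (210 * ((2 * (d : ℝ) + 2) * L)) ^ 2 * α ^ 2 with hCD
  have hsh : ∀ ν : Fin d, ∑ z : Fin d → Fin N', ∑ κ : Fin d, ‖Dq ((L : ℤ) • (boxVec N' z + e ν)) κ‖ ^ 2 ≤ CD * (2 * d) * MASS := fun ν => by
    simp only [hDq, hMASS, hCD]
    exact sum_cell_trueStep_defect_sq_le_shift L N' hL V hV X hX hα hα24 (e ν)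
  have h0 : ∑ z : Fin d → Fin N', ∑ κ : Fin d, ‖Dq ((L : ℤ) • boxVec N' z) κ‖ ^ 2 ≤ CD * (2 * d) * MASS := by
    have h := sum_cell_trueStep_defect_sq_le_shift L N' hL V hV X hX hα hα24 (0 : Site d)
    simp only [add_zero] at h
    simp only [hDq, hMASS, hCD]
    exact h
  have h5 : ∑ z : Fin d → Fin N', ∑ κ : Fin d, ∑ ν : Fin d, Cd (z, κ, ν) ^ 2 ≤ (CD * (8 * (d : ℝ) ^ 2)) * MASS := by
    calc ∑ z : Fin d → Fin N', ∑ κ : Fin d, ∑ ν : Fin d, Cd (z, κ, ν) ^ 2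
        ≤ ∑ z : Fin d → Fin N', ∑ κ : Fin d, ∑ ν : Fin d,
            (2 * ‖Dq ((L : ℤ) • (boxVec N' z + e ν)) κ‖ ^ 2 + 2 * ‖Dq ((L : ℤ) • boxVec N' z) κ‖ ^ 2) := by
          refine Finset.sum_le_sum fun z _ => Finset.sum_le_sum fun κ _ => Finset.sum_le_sum fun ν _ => ?_
          simp only [hCd]
          nlinarith [sq_nonneg (‖Dq ((L : ℤ) • (boxVec N' z + e ν)) κ‖ - ‖Dq ((L : ℤ) • boxVec N' z) κ‖)]
      _ = 2 * ∑ ν : Fin d, ∑ z : Fin d → Fin N', ∑ κ : Fin d, ‖Dq ((L : ℤ) • (boxVec N' z + e ν)) κ‖ ^ 2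
          + 2 * (d * ∑ z : Fin d → Fin N', ∑ κ : Fin d, ‖Dq ((L : ℤ) • boxVec N' z) κ‖ ^ 2) := by
          simp only [Finset.sum_add_distrib, Finset.sum_const, Finset.card_univ, Fintype.card_fin, nsmul_eq_mul, ← Finset.mul_sum]
          rw [sum_comm₃' (fun z κ ν => ‖Dq ((L : ℤ) • (boxVec N' z + e ν)) κ‖ ^ 2)]
          simp only [Finset.mul_sum]
          congr 1
          exact Finset.sum_congr rfl fun z _ => Finset.sum_congr rfl fun κ _ => by ring
      _ ≤ 2 * ∑ ν : Fin d, (CD * (2 * d) * MASS) + 2 * (d * (CD * (2 * d) * MASS)) :=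
          add_le_add (mul_le_mul_of_nonneg_left (Finset.sum_le_sum fun ν _ => hsh ν) (by norm_num))
            (mul_le_mul_of_nonneg_left (mul_le_mul_of_nonneg_left h0 (Nat.cast_nonneg _)) (by norm_num))
      _ = (CD * (8 * (d : ℝ) ^ 2)) * MASS := by
          rw [Finset.sum_const, Finset.card_univ, Fintype.card_fin, nsmul_eq_mul]; ring
  have hMASS0 : 0 ≤ MASS := by positivity
  have h3' : Real.sqrt (∑ z : Fin d → Fin N', ∑ κ : Fin d, ∑ ν : Fin d, A (z, κ, ν) ^ 2)
      ≤ Real.sqrt ((L : ℝ) ^ 4 * c) * Real.sqrt (∑ κ : Fin d, ∑ ν : Fin d, CELLG κ ν) := by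
    rw [← Real.sqrt_mul (by positivity)]
    refine Real.sqrt_le_sqrt ?_
    rw [sum_comm₃ (fun z κ ν => A (z, κ, ν) ^ 2), Finset.mul_sum]
    refine Finset.sum_le_sum fun κ _ => ?_
    rw [Finset.mul_sum]
    exact Finset.sum_le_sum fun ν _ => h3 κ ν
  have h4' : Real.sqrt (∑ z : Fin d → Fin N', ∑ κ : Fin d, ∑ ν : Fin d, B (z, κ, ν) ^ 2)
      ≤ K * Real.sqrt (d * ((L : ℝ) ^ 2 * c)) * Real.sqrt MASS := by
    have hsum : ∑ z : Fin d → Fin N', ∑ κ : Fin d, ∑ ν : Fin d, B (z, κ, ν) ^ 2 ≤ (K ^ 2 * (d * ((L : ℝ) ^ 2 * c))) * MASS := by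
      rw [sum_comm₃ (fun z κ ν => B (z, κ, ν) ^ 2)]
      calc ∑ κ : Fin d, ∑ ν : Fin d, ∑ z : Fin d → Fin N', B (z, κ, ν) ^ 2
          ≤ ∑ κ : Fin d, ∑ ν : Fin d, (K ^ 2 * ((L : ℝ) ^ 2 * c)) * CELLM κ :=
            Finset.sum_le_sum fun κ _ => Finset.sum_le_sum fun ν _ => h4 κ ν
        _ = (K ^ 2 * (d * ((L : ℝ) ^ 2 * c))) * MASS := by
            simp only [Finset.sum_const, Finset.card_univ, Fintype.card_fin, nsmul_eq_mul]
            rw [← hMASS', Finset.mul_sum]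
            exact Finset.sum_congr rfl fun κ _ => by ring
    have e1 : Real.sqrt ((K ^ 2 * (d * ((L : ℝ) ^ 2 * c))) * MASS) = K * Real.sqrt (d * ((L : ℝ) ^ 2 * c)) * Real.sqrt MASS := by
      rw [Real.sqrt_mul (by positivity), Real.sqrt_mul (sq_nonneg K), Real.sqrt_sq hK0]
    rw [← e1]
    exact Real.sqrt_le_sqrt hsum
  have h5' : Real.sqrt (∑ z : Fin d → Fin N', ∑ κ : Fin d, ∑ ν : Fin d, Cd (z, κ, ν) ^ 2)
      ≤ 210 * ((2 * d + 2) * L) * α * Real.sqrt (8 * (d : ℝ) ^ 2) * Real.sqrt MASS := by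
    have hK5 : 0 ≤ 210 * ((2 * (d : ℝ) + 2) * L) * α := by positivity
    have e1 : (CD * (8 * (d : ℝ) ^ 2)) * MASS = (210 * ((2 * (d : ℝ) + 2) * L) * α) ^ 2 * ((8 * (d : ℝ) ^ 2) * MASS) := by
      rw [hCD]; ring
    rw [e1] at h5
    calc _ ≤ Real.sqrt ((210 * ((2 * (d : ℝ) + 2) * L) * α) ^ 2 * ((8 * (d : ℝ) ^ 2) * MASS)) := Real.sqrt_le_sqrt h5
      _ = _ := by rw [Real.sqrt_mul (sq_nonneg _), Real.sqrt_sq hK5, Real.sqrt_mul (by positivity)]; ring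
  have eG : ∑ t' : Fin d → Fin (N' * L), ∑ κ : Fin d, ∑ ν : Fin d,
      ‖conjR (V (boxVec (N' * L) t') ν) (X (boxVec (N' * L) t' + e ν) κ) - X (boxVec (N' * L) t') κ‖ ^ 2 = ∑ κ : Fin d, ∑ ν : Fin d, CELLG κ ν := by
    simp only [hCELLG, hG]
    exact sum_comm₃ _
  rw [eG, add_mul]
  refine hMink.trans ?_
  linarith [h3', h4', h5']

end Row

end Summit.QuantumFields.YangMills.Theorems.Prop7CornerCombCovGradStep

end
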